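import Summits.AtomisticToContinuum.FouriersLaw.Theorems.HiddenChargeMazurStaticKuboStubLasotaYorkeHigh
import Summits.AtomisticToContinuum.FouriersLaw.Theorems.HiddenChargeMazurStaticKuboStubLasotaYorkeLow
import Summits.AtomisticToContinuum.FouriersLaw.Theorems.HiddenChargeMazurStaticKuboStubLasotaYorkeConstants

/-!
# `HiddenChargeMazur.StaticKubo`, line `birth`, stub S5 `stub_lasotaYorke` — the Doeblin–Fortet inequality

Stub file (`--supports stmt-AtomisticToContinuum-13510`, crux decl `HiddenChargeMazur.StaticKubo`,
skeleton `Cruxes/StaticKubo/Lines/birth.lean` rev 4; the lead's own stub).  Assembly of auxs 1–6: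

given the two-point Grönwall bound (S1), the high-energy decay with a rate (core of S3) and the local
smoothing bound (S4) — all three LANDED, and taken here as the registered hypotheses — for the pinned chain
(all parameters `> 0`), `N ≥ 2`, `T > 0`, `0 < ϑ < θ₁ < 1/(2T)` there is `C₀ ≥ 0` with

* (a) the ONE-STEP DOEBLIN–FORTET (Lasota–Yorke) INEQUALITY for the weighted pair-Lipschitz seminorm under the
  unit-time equilibrium kernel: an observable of value class `ϑ` with constant `M` and pair constant `K` at `θ₁`
  has forecast `P_1φ` with pair constant `K/2 + C₀M` — HIGH pairs (both energies above the threshold) by the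
  synchronous coupling and the high-energy contraction of the weight (aux 4), LOW pairs by the cutoff split:
  smooth part through S4, cut-off part through the coupling with the rare event `{R < H(X_1)}` (aux 5);
* (b) the forecasts `P_tJ`, `t ≤ 1`, of the total current have pair constant `C₀` (aux 4).

References: folklore (coupling; Doeblin–Fortet / Lasota–Yorke; Cuneo–Eckmann–Hairer–Rey-Bellet 2018 Thm 5.1 for the
high-energy input). This file closes the stub `stub_lasotaYorke`; with it every stub of the rev-4 skeleton has landed.
-/

noncomputable section

open MeasureTheory Filter Topology Set Metric
open scoped NNReal ENNReal
open Literature.MathematicalPhysics.KineticTheory.HeatConduction Literature.MathematicalPhysics.KineticTheory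
open Literature.Probability.Process OscillatorChain

namespace Summit.AtomisticToContinuum.FouriersLaw.Cruxes.StaticKubo.Birth.Stubs

-- the flow is a limit of Picard iterations: never let the unifier unfold it (heartbeats)
attribute [local irreducible] OscillatorChain.chainFlow

/-- **S5 — `stub_lasotaYorke` (the one-step Doeblin–Fortet inequality for the weighted pair-Lipschitz seminorm,
and the pair bound of the current forecasts), PROVED** from the registered hypotheses S1 (two-point Grönwall),
the core of S3 (high-energy decay with a rate) and S4 (local smoothing). [folklore] -/
theorem stub_lasotaYorke :
    (∀ ω₂ lam β γ : ℝ, 0 < ω₂ → 0 < lam → 0 ≤ β → 0 ≤ γ → ∀ N : ℕ, ∃ C₀ : ℝ, 0 ≤ C₀ ∧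
      ∀ η : ℝ → Fin N → ℝ, Continuous η → ∀ (x y : PhaseSpace N) (t : ℝ), 0 ≤ t →
        ‖(pinnedChain ω₂ lam β γ).chainFlow N x η t - (pinnedChain ω₂ lam β γ).chainFlow N y η t‖ ≤
          ‖x - y‖ * Real.exp (∫ s in (0 : ℝ)..t, C₀ * (1 +
            Real.sqrt ((pinnedChain ω₂ lam β γ).hamiltonian N ((pinnedChain ω₂ lam β γ).chainFlow N x η s)) +
            Real.sqrt ((pinnedChain ω₂ lam β γ).hamiltonian N ((pinnedChain ω₂ lam β γ).chainFlow N y η s))))) →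
    (∀ ω₂ lam β γ : ℝ, 0 < ω₂ → 0 < lam → 0 < β → 0 < γ → ∀ N : ℕ, 1 < N → ∀ T_L T_R : ℝ, 0 < T_L → 0 < T_R →
      ∀ θ : ℝ, 0 < θ → θ < 1 / max T_L T_R → ∀ tstar : ℝ, 0 < tstar →
        ∃ c C E₀ : ℝ, 0 < c ∧ ∀ x : PhaseSpace N, E₀ ≤ (pinnedChain ω₂ lam β γ).hamiltonian N x →
          ∫⁻ ω, ENNReal.ofReal (Real.exp (θ * (pinnedChain ω₂ lam β γ).hamiltonian N
              ((pinnedChain ω₂ lam β γ).solMap N T_L T_R tstar x (pairPath ω)))) ∂wienerPair ≤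
            ENNReal.ofReal (C * Real.exp (θ * (pinnedChain ω₂ lam β γ).hamiltonian N x -
              c * (pinnedChain ω₂ lam β γ).hamiltonian N x ^ (3 / 4 : ℝ)))) →
    (∀ ω₂ lam β γ : ℝ, 0 < ω₂ → 0 ≤ lam → 0 ≤ β → 0 < γ → ∀ N : ℕ, 0 < N → ∀ T_L T_R : ℝ, 0 < T_L → 0 ≤ T_R →
      ∀ t : ℝ≥0, 0 < (t : ℝ) → ∀ R E₁ : ℝ, ∃ C : ℝ, 0 ≤ C ∧ ∀ F : PhaseSpace N → ℝ, Measurable F →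
        (∀ y, |F y| ≤ 1) → (∀ y, R < (pinnedChain ω₂ lam β γ).hamiltonian N y → F y = 0) →
        ∀ x x' : PhaseSpace N, (pinnedChain ω₂ lam β γ).hamiltonian N x ≤ E₁ →
          (pinnedChain ω₂ lam β γ).hamiltonian N x' ≤ E₁ →
          |(∫ y, F y ∂((pinnedChain ω₂ lam β γ).transitionKernel N T_L T_R t x)) -
              ∫ y, F y ∂((pinnedChain ω₂ lam β γ).transitionKernel N T_L T_R t x')| ≤ C * ‖x - x'‖) →
    ∀ ω₂ lam β γ : ℝ, 0 < ω₂ → 0 < lam → 0 < β → 0 < γ → ∀ N : ℕ, 2 ≤ N → ∀ T : ℝ, 0 < T →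
      ∀ ϑ θ₁ : ℝ, 0 < ϑ → ϑ < θ₁ → θ₁ < 1 / (2 * T) →
      ∃ C₀ : ℝ, 0 ≤ C₀ ∧
        (∀ φ : PhaseSpace N → ℝ, Continuous φ → ∀ Mφ Kφ : ℝ, 0 ≤ Mφ → 0 ≤ Kφ →
          (∀ x, |φ x| ≤ Mφ * Real.exp (ϑ * (pinnedChain ω₂ lam β γ).hamiltonian N x)) →
          (∀ x y, ‖x - y‖ ≤ 1 → |φ x - φ y| ≤ Kφ * ‖x - y‖ *
            (Real.exp (θ₁ * (pinnedChain ω₂ lam β γ).hamiltonian N x) +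
              Real.exp (θ₁ * (pinnedChain ω₂ lam β γ).hamiltonian N y))) →
          ∀ x y, ‖x - y‖ ≤ 1 →
            |(∫ z, φ z ∂((pinnedChain ω₂ lam β γ).transitionKernel N T T 1 x)) -
                ∫ z, φ z ∂((pinnedChain ω₂ lam β γ).transitionKernel N T T 1 y)| ≤
              (Kφ / 2 + C₀ * Mφ) * ‖x - y‖ *
                (Real.exp (θ₁ * (pinnedChain ω₂ lam β γ).hamiltonian N x) +
                  Real.exp (θ₁ * (pinnedChain ω₂ lam β γ).hamiltonian N y))) ∧
        (∀ t : ℝ≥0, (t : ℝ) ≤ 1 → ∀ x y : PhaseSpace N, ‖x - y‖ ≤ 1 →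
          |(∫ z, (∑ i : Fin N, (pinnedChain ω₂ lam β γ).bondCurrent N i z)
                ∂((pinnedChain ω₂ lam β γ).transitionKernel N T T t x)) -
              ∫ z, (∑ i : Fin N, (pinnedChain ω₂ lam β γ).bondCurrent N i z)
                ∂((pinnedChain ω₂ lam β γ).transitionKernel N T T t y)| ≤
            C₀ * ‖x - y‖ *
              (Real.exp (θ₁ * (pinnedChain ω₂ lam β γ).hamiltonian N x) +
                Real.exp (θ₁ * (pinnedChain ω₂ lam β γ).hamiltonian N y)))  := by
  intro hS1 hS3 hS4 ω₂ lam β γ hω hl hβ hγ N hN2 T hT ϑ θ₁ hϑ hϑθ hθT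
  have hN : 0 < N := by omega
  have hN1 : 1 < N := by omega
  have hH0 : ∀ z : PhaseSpace N, 0 ≤ (pinnedChain ω₂ lam β γ).hamiltonian N z := fun z => pinnedChain_hamiltonian_nonneg hω.le hl.le hβ.le γ N z
  have hθ0 : 0 < θ₁ := hϑ.trans hϑθ
  have hϑT2 : ϑ < 1 / (2 * T) := hϑθ.trans hθT
  have hθT' : θ₁ < 1 / T := hθT.trans (by rw [div_lt_div_iff₀ (by positivity) hT]; linarith)
  have hϑT : ϑ < 1 / T := hϑθ.trans hθT'
  -- S1: the unit-window coupling bound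
  obtain ⟨C₀, hC₀, hS1'⟩ := hS1 ω₂ lam β γ hω hl hβ.le hγ.le N
  have hD : ∀ (t : ℝ≥0), (t : ℝ) ≤ 1 → ∀ (x y : PhaseSpace N) (ω : WienerPair),
      ‖(pinnedChain ω₂ lam β γ).solMap N T T t x (pairPath ω) - (pinnedChain ω₂ lam β γ).solMap N T T t y (pairPath ω)‖ ≤
      ‖x - y‖ * Real.exp (∫ s in (0 : ℝ)..1, C₀ * (1 +
        Real.sqrt ((pinnedChain ω₂ lam β γ).hamiltonian N ((pinnedChain ω₂ lam β γ).solMap N T T s x (pairPath ω))) +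
        Real.sqrt ((pinnedChain ω₂ lam β γ).hamiltonian N ((pinnedChain ω₂ lam β γ).solMap N T T s y (pairPath ω))))) :=
    fun t ht x y ω => norm_solMap_sub_le_of_twoPoint hω hl.le hβ.le hγ.le hC₀ hS1' t ht x y ω
  -- S3 at the exponent `2θ₁` and time `1`
  have h2θ : 0 < 2 * θ₁ := by positivity
  have h2θ' : 2 * θ₁ < 1 / max T T := by
    rw [max_self, lt_div_iff₀ hT]; rw [lt_div_iff₀ (by positivity)] at hθT; linarith
  obtain ⟨c₃, C₃, E₀, hc₃, hHED⟩ := hS3 ω₂ lam β γ hω hl hβ hγ N hN1 T T hT hT (2 * θ₁) h2θ h2θ' 1 one_pos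
  have hHED' : ∀ z : PhaseSpace N, E₀ ≤ (pinnedChain ω₂ lam β γ).hamiltonian N z →
      ∫⁻ ω, ENNReal.ofReal (Real.exp (2 * θ₁ * (pinnedChain ω₂ lam β γ).hamiltonian N ((pinnedChain ω₂ lam β γ).solMap N T T 1 z (pairPath ω)))) ∂wienerPair ≤
        ENNReal.ofReal (max C₃ 0 * Real.exp (2 * θ₁ * (pinnedChain ω₂ lam β γ).hamiltonian N z - c₃ * (pinnedChain ω₂ lam β γ).hamiltonian N z ^ (3 / 4 : ℝ))) :=
    fun z hz => (hHED z hz).trans (ENNReal.ofReal_le_ofReal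
      (mul_le_mul_of_nonneg_right (le_max_left _ _) (Real.exp_pos _).le))
  -- the high threshold `E₁` and the weight-absorption constant `CM`
  obtain ⟨E₁, -, hE₁⟩ := exists_threshold (C₀ + (8 * C₀ ^ 2 * T + γ) / 2 + (2 * C₀ ^ 2 * T + 1 / (8 * T)) * Real.exp ((N * (ω₂ / 2 + 3 + lam / ω₂ + N ^ 2 * (3 + β)) + N / 2 + 1) / 2)) ((2 * C₀ ^ 2 * T + 1 / (8 * T)) * (1 + Real.exp ((N * (ω₂ / 2 + 3 + lam / ω₂ + N ^ 2 * (3 + β)) + N / 2 + 1) / 2))) (Real.sqrt (max C₃ 0)) (c₃ / 2) (by positivity)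
  obtain ⟨CM, hCM0, hCM⟩ : ∃ CM : ℝ, 0 ≤ CM ∧ ∀ h : ℝ, 0 ≤ h →
      Real.exp ((C₀ + (8 * C₀ ^ 2 * T + γ) / 2 + (2 * C₀ ^ 2 * T + 1 / (8 * T)) * Real.exp ((N * (ω₂ / 2 + 3 + lam / ω₂ + N ^ 2 * (3 + β)) + N / 2 + 1) / 2)) + ((2 * C₀ ^ 2 * T + 1 / (8 * T)) * (1 + Real.exp ((N * (ω₂ / 2 + 3 + lam / ω₂ + N ^ 2 * (3 + β)) + N / 2 + 1) / 2))) * Real.sqrt h) * (Real.exp (2 * ϑ * γ * T) * Real.exp (ϑ * h)) ≤ CM * Real.exp (θ₁ * h) :=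
    ⟨_, (Real.exp_pos _).le, fun h hh => weight_absorb _ _ ϑ θ₁ γ T h hϑθ hh⟩
  -- the low shell `EL`, the level `U`, the cutoff level `R`
  obtain ⟨EL, hEL0, hEL⟩ : ∃ EL : ℝ, 0 ≤ EL ∧ ∀ x y : PhaseSpace N, ‖x - y‖ ≤ 1 → (pinnedChain ω₂ lam β γ).hamiltonian N x < max E₀ E₁ →
      (pinnedChain ω₂ lam β γ).hamiltonian N x ≤ EL ∧ (pinnedChain ω₂ lam β γ).hamiltonian N y ≤ EL :=
    ⟨(Real.exp (N * (ω₂ / 2 + 3 + lam / ω₂ + N ^ 2 * (3 + β)) + N / 2 + 1) * (1 + |max E₀ E₁|)), by positivity, fun x y hxy hx => hamiltonian_le_lowShell hω hl.le hβ.le γ N x y hxy hx⟩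
  obtain ⟨U, hU⟩ : ∃ U : ℝ, ∀ x y : PhaseSpace N, (pinnedChain ω₂ lam β γ).hamiltonian N x ≤ EL → (pinnedChain ω₂ lam β γ).hamiltonian N y ≤ EL → (4 * C₀ + (32 * C₀ ^ 2 * T + γ) + (16 * C₀ ^ 2 * T + 1 / (4 * T)) * (Real.sqrt ((pinnedChain ω₂ lam β γ).hamiltonian N x) + Real.sqrt ((pinnedChain ω₂ lam β γ).hamiltonian N y))) ≤ U := by
    refine ⟨4 * C₀ + (32 * C₀ ^ 2 * T + γ) + (16 * C₀ ^ 2 * T + 1 / (4 * T)) * (2 * Real.sqrt EL), fun x y hx hy => ?_⟩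
    have hsx : Real.sqrt ((pinnedChain ω₂ lam β γ).hamiltonian N x) ≤ Real.sqrt EL := Real.sqrt_le_sqrt hx
    have hsy : Real.sqrt ((pinnedChain ω₂ lam β γ).hamiltonian N y) ≤ Real.sqrt EL := Real.sqrt_le_sqrt hy
    have hc : 0 ≤ 16 * C₀ ^ 2 * T + 1 / (4 * T) := by positivity
    have h := mul_le_mul_of_nonneg_left (add_le_add hsx hsy) hc
    have h2 : Real.sqrt EL + Real.sqrt EL = 2 * Real.sqrt EL := by ring
    rw [h2] at h
    linarith
  obtain ⟨R, hR0, hRge⟩ : ∃ R : ℝ, 0 ≤ R ∧ EL + 2 * γ * T + 4 / θ₁ * (U / 4 + Real.log 2 + 2 * θ₁ * γ * T) ≤ R :=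
    ⟨max 0 (EL + 2 * γ * T + 4 / θ₁ * (U / 4 + Real.log 2 + 2 * θ₁ * γ * T)), le_max_left _ _, le_max_right _ _⟩
  -- the smoothing constant (S4) and the current constant
  obtain ⟨CS, hCS0, hS4'⟩ := hS4 ω₂ lam β γ hω hl.le hβ.le hγ N hN T T hT hT.le 1 (by norm_num) (R + 1) EL
  obtain ⟨Cb, hCb0, hb⟩ := current_forecast_pair_bound hω hl.le hβ.le hγ.le hN hT hC₀ hD hϑ hϑT2
  have hlam : 0 ≤ lam / ω₂ := div_nonneg hl.le hω.le
  have hL1 : 0 ≤ ((N * (ω₂ / 2 + 3 + lam / ω₂ + N ^ 2 * (3 + β)) + N / 2 + 1) * Real.exp (N * (ω₂ / 2 + 3 + lam / ω₂ + N ^ 2 * (3 + β)) + N / 2 + 1) * (R + 2)) + 1 := by positivity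
  -- the constant of the stub
  set Clow : ℝ := Real.exp (ϑ * (R + 1)) * CS / 2 + (((N * (ω₂ / 2 + 3 + lam / ω₂ + N ^ 2 * (3 + β)) + N / 2 + 1) * Real.exp (N * (ω₂ / 2 + 3 + lam / ω₂ + N ^ 2 * (3 + β)) + N / 2 + 1) * (R + 2)) + 1) * CM with hClow
  have hClow0 : 0 ≤ Clow := by positivity
  refine ⟨max CM (max Clow (Cb * CM)), le_max_of_le_left hCM0, ?_, ?_⟩
  · ------------------------------------------------------------------
    -- (a) the Doeblin–Fortet inequality
    ------------------------------------------------------------------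
    intro φ hφ Mφ Kφ hM hK hval hpair x y hxy
    have hyx : ‖y - x‖ ≤ 1 := by rwa [norm_sub_rev]
    have hGx : Real.sqrt (Real.exp (2 * C₀ + (8 * C₀ ^ 2 * T + γ) + (4 * C₀ ^ 2 * T + 1 / (4 * T)) * (Real.sqrt ((pinnedChain ω₂ lam β γ).hamiltonian N x) + Real.sqrt ((pinnedChain ω₂ lam β γ).hamiltonian N y)))) ≤ Real.exp ((C₀ + (8 * C₀ ^ 2 * T + γ) / 2 + (2 * C₀ ^ 2 * T + 1 / (8 * T)) * Real.exp ((N * (ω₂ / 2 + 3 + lam / ω₂ + N ^ 2 * (3 + β)) + N / 2 + 1) / 2)) + ((2 * C₀ ^ 2 * T + 1 / (8 * T)) * (1 + Real.exp ((N * (ω₂ / 2 + 3 + lam / ω₂ + N ^ 2 * (3 + β)) + N / 2 + 1) / 2))) * Real.sqrt ((pinnedChain ω₂ lam β γ).hamiltonian N x)) :=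
      sqrt_flowMoment_le hω hl.le hβ.le γ N hT γ x y hxy
    have hGy : Real.sqrt (Real.exp (2 * C₀ + (8 * C₀ ^ 2 * T + γ) + (4 * C₀ ^ 2 * T + 1 / (4 * T)) * (Real.sqrt ((pinnedChain ω₂ lam β γ).hamiltonian N x) + Real.sqrt ((pinnedChain ω₂ lam β γ).hamiltonian N y)))) ≤ Real.exp ((C₀ + (8 * C₀ ^ 2 * T + γ) / 2 + (2 * C₀ ^ 2 * T + 1 / (8 * T)) * Real.exp ((N * (ω₂ / 2 + 3 + lam / ω₂ + N ^ 2 * (3 + β)) + N / 2 + 1) / 2)) + ((2 * C₀ ^ 2 * T + 1 / (8 * T)) * (1 + Real.exp ((N * (ω₂ / 2 + 3 + lam / ω₂ + N ^ 2 * (3 + β)) + N / 2 + 1) / 2))) * Real.sqrt ((pinnedChain ω₂ lam β γ).hamiltonian N y)) := by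
      have h := sqrt_flowMoment_le hω hl.le hβ.le γ N (C₀ := C₀) hT γ y x hyx
      rwa [add_comm (Real.sqrt ((pinnedChain ω₂ lam β γ).hamiltonian N y)) (Real.sqrt ((pinnedChain ω₂ lam β γ).hamiltonian N x))] at h
    -- absorbing the rate factor into the weights
    have t3 : Real.sqrt (Real.exp (2 * C₀ + (8 * C₀ ^ 2 * T + γ) + (4 * C₀ ^ 2 * T + 1 / (4 * T)) * (Real.sqrt ((pinnedChain ω₂ lam β γ).hamiltonian N x) + Real.sqrt ((pinnedChain ω₂ lam β γ).hamiltonian N y)))) * (Real.exp (2 * ϑ * γ * T) * Real.exp (ϑ * (pinnedChain ω₂ lam β γ).hamiltonian N x)) ≤ CM * Real.exp (θ₁ * (pinnedChain ω₂ lam β γ).hamiltonian N x) :=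
      (mul_le_mul_of_nonneg_right hGx (by positivity)).trans (hCM _ (hH0 x))
    have t4 : Real.sqrt (Real.exp (2 * C₀ + (8 * C₀ ^ 2 * T + γ) + (4 * C₀ ^ 2 * T + 1 / (4 * T)) * (Real.sqrt ((pinnedChain ω₂ lam β γ).hamiltonian N x) + Real.sqrt ((pinnedChain ω₂ lam β γ).hamiltonian N y)))) * (Real.exp (2 * ϑ * γ * T) * Real.exp (ϑ * (pinnedChain ω₂ lam β γ).hamiltonian N y)) ≤ CM * Real.exp (θ₁ * (pinnedChain ω₂ lam β γ).hamiltonian N y) :=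
      (mul_le_mul_of_nonneg_right hGy (by positivity)).trans (hCM _ (hH0 y))
    have hxy0 : 0 ≤ ‖x - y‖ := norm_nonneg _
    have hWx0 : 0 ≤ Real.exp (θ₁ * (pinnedChain ω₂ lam β γ).hamiltonian N x) := (Real.exp_pos _).le
    have hWy0 : 0 ≤ Real.exp (θ₁ * (pinnedChain ω₂ lam β γ).hamiltonian N y) := (Real.exp_pos _).le
    by_cases hhi : max E₀ E₁ ≤ (pinnedChain ω₂ lam β γ).hamiltonian N x ∧ max E₀ E₁ ≤ (pinnedChain ω₂ lam β γ).hamiltonian N y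
    · -- HIGH pairs
      have hx0 : E₀ ≤ (pinnedChain ω₂ lam β γ).hamiltonian N x := (le_max_left _ _).trans hhi.1
      have hy0 : E₀ ≤ (pinnedChain ω₂ lam β γ).hamiltonian N y := (le_max_left _ _).trans hhi.2
      have hx1 : E₁ ≤ (pinnedChain ω₂ lam β γ).hamiltonian N x := (le_max_right _ _).trans hhi.1
      have hy1 : E₁ ≤ (pinnedChain ω₂ lam β γ).hamiltonian N y := (le_max_right _ _).trans hhi.2
      have h := high_forecast_pair_bound hω hl.le hβ.le hγ.le hN hT hC₀ hD hϑ hϑθ hθT (le_max_right C₃ 0) hHED'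
        hφ hM hK hval hpair x y hx0 hy0
      refine h.trans ?_
      have t1 : Real.sqrt (Real.exp (2 * C₀ + (8 * C₀ ^ 2 * T + γ) + (4 * C₀ ^ 2 * T + 1 / (4 * T)) * (Real.sqrt ((pinnedChain ω₂ lam β γ).hamiltonian N x) + Real.sqrt ((pinnedChain ω₂ lam β γ).hamiltonian N y)))) * (Real.sqrt (max C₃ 0) * Real.exp (θ₁ * (pinnedChain ω₂ lam β γ).hamiltonian N x - c₃ / 2 * (pinnedChain ω₂ lam β γ).hamiltonian N x ^ (3 / 4 : ℝ))) ≤ Real.exp (θ₁ * (pinnedChain ω₂ lam β γ).hamiltonian N x) / 2 :=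
        (mul_le_mul_of_nonneg_right hGx (by positivity)).trans (high_absorb _ _ _ _ θ₁ _ (hE₁ _ hx1))
      have t2 : Real.sqrt (Real.exp (2 * C₀ + (8 * C₀ ^ 2 * T + γ) + (4 * C₀ ^ 2 * T + 1 / (4 * T)) * (Real.sqrt ((pinnedChain ω₂ lam β γ).hamiltonian N x) + Real.sqrt ((pinnedChain ω₂ lam β γ).hamiltonian N y)))) * (Real.sqrt (max C₃ 0) * Real.exp (θ₁ * (pinnedChain ω₂ lam β γ).hamiltonian N y - c₃ / 2 * (pinnedChain ω₂ lam β γ).hamiltonian N y ^ (3 / 4 : ℝ))) ≤ Real.exp (θ₁ * (pinnedChain ω₂ lam β γ).hamiltonian N y) / 2 :=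
        (mul_le_mul_of_nonneg_right hGy (by positivity)).trans (high_absorb _ _ _ _ θ₁ _ (hE₁ _ hy1))
      have hK1 : Kφ / 2 + CM * Mφ ≤ Kφ / 2 + max CM (max Clow (Cb * CM)) * Mφ :=
        add_le_add le_rfl (mul_le_mul_of_nonneg_right (le_max_left _ _) hM)
      set Gs := Real.sqrt (Real.exp (2 * C₀ + (8 * C₀ ^ 2 * T + γ) + (4 * C₀ ^ 2 * T + 1 / (4 * T)) * (Real.sqrt ((pinnedChain ω₂ lam β γ).hamiltonian N x) + Real.sqrt ((pinnedChain ω₂ lam β γ).hamiltonian N y)))) with hGs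
      set Wx := Real.exp (θ₁ * (pinnedChain ω₂ lam β γ).hamiltonian N x) with hWx
      set Wy := Real.exp (θ₁ * (pinnedChain ω₂ lam β γ).hamiltonian N y) with hWy
      set Vx := Real.exp (ϑ * (pinnedChain ω₂ lam β γ).hamiltonian N x) with hVx
      set Vy := Real.exp (ϑ * (pinnedChain ω₂ lam β γ).hamiltonian N y) with hVy
      set ex := Real.exp (θ₁ * (pinnedChain ω₂ lam β γ).hamiltonian N x - c₃ / 2 * (pinnedChain ω₂ lam β γ).hamiltonian N x ^ (3 / 4 : ℝ)) with hex
      set ey := Real.exp (θ₁ * (pinnedChain ω₂ lam β γ).hamiltonian N y - c₃ / 2 * (pinnedChain ω₂ lam β γ).hamiltonian N y ^ (3 / 4 : ℝ)) with hey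
      set sC := Real.sqrt (max C₃ 0) with hsC
      set e2 := Real.exp (2 * ϑ * γ * T) with he2
      calc ‖x - y‖ * (Gs * (Kφ * (sC * (ex + ey)) + Mφ * (e2 * (Vx + Vy))))
          = ‖x - y‖ * (Kφ * (Gs * (sC * ex) + Gs * (sC * ey)) + Mφ * (Gs * (e2 * Vx) + Gs * (e2 * Vy))) := by ring
        _ ≤ ‖x - y‖ * (Kφ * (Wx / 2 + Wy / 2) + Mφ * (CM * Wx + CM * Wy)) :=
          mul_le_mul_of_nonneg_left (add_le_add (mul_le_mul_of_nonneg_left (add_le_add t1 t2) hK)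
            (mul_le_mul_of_nonneg_left (add_le_add t3 t4) hM)) hxy0
        _ = (Kφ / 2 + CM * Mφ) * ‖x - y‖ * (Wx + Wy) := by ring
        _ ≤ (Kφ / 2 + max CM (max Clow (Cb * CM)) * Mφ) * ‖x - y‖ * (Wx + Wy) :=
          mul_le_mul_of_nonneg_right (mul_le_mul_of_nonneg_right hK1 hxy0) (add_nonneg hWx0 hWy0)
    · -- LOW pairs: both energies in the shell
      have hlow : (pinnedChain ω₂ lam β γ).hamiltonian N x ≤ EL ∧ (pinnedChain ω₂ lam β γ).hamiltonian N y ≤ EL := by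
        rcases not_and_or.1 hhi with h1 | h1
        · exact hEL x y hxy (not_le.1 h1)
        · have h := hEL y x hyx (not_le.1 h1)
          exact ⟨h.2, h.1⟩
      have hsplit := abs_forecast_sub_le_split hω hl.le hβ.le hγ.le hN hT hφ hϑ hϑT hval R x y
      have hsm := smooth_forecast_pair_bound (ω₂ := ω₂) (lam := lam) (β := β) (γ := γ) (N := N) (T := T) hS4' hφ hM hϑ.le hval
        x y hlow.1 hlow.2
      have hco := cutoff_forecast_pair_bound hω hl.le hβ.le hγ.le hN hT hC₀ x y (hD 1 (by norm_num) x y) hϑ hϑθ hθT hR0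
        hφ hM hK hval hpair
      refine hsplit.trans ((add_le_add hsm hco).trans ?_)
      have hsmall := low_small θ₁ γ T (4 * C₀ + (32 * C₀ ^ 2 * T + γ) + (16 * C₀ ^ 2 * T + 1 / (4 * T)) * (Real.sqrt ((pinnedChain ω₂ lam β γ).hamiltonian N x) + Real.sqrt ((pinnedChain ω₂ lam β γ).hamiltonian N y))) U EL ((pinnedChain ω₂ lam β γ).hamiltonian N x) R hθ0 (hU x y hlow.1 hlow.2) hlow.1 hRge
      have hW2 : ‖x - y‖ ≤ ‖x - y‖ * ((Real.exp (θ₁ * (pinnedChain ω₂ lam β γ).hamiltonian N x) + Real.exp (θ₁ * (pinnedChain ω₂ lam β γ).hamiltonian N y)) / 2) := by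
        have h1 : (1 : ℝ) ≤ Real.exp (θ₁ * (pinnedChain ω₂ lam β γ).hamiltonian N x) := Real.one_le_exp (mul_nonneg hθ0.le (hH0 x))
        have h2 : (1 : ℝ) ≤ Real.exp (θ₁ * (pinnedChain ω₂ lam β γ).hamiltonian N y) := Real.one_le_exp (mul_nonneg hθ0.le (hH0 y))
        have h12 : (1 : ℝ) ≤ (Real.exp (θ₁ * (pinnedChain ω₂ lam β γ).hamiltonian N x) + Real.exp (θ₁ * (pinnedChain ω₂ lam β γ).hamiltonian N y)) / 2 := by linarith
        calc ‖x - y‖ = ‖x - y‖ * 1 := (mul_one _).symm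
          _ ≤ _ := mul_le_mul_of_nonneg_left h12 hxy0
      have hK2 : Kφ / 2 + Clow * Mφ ≤ Kφ / 2 + max CM (max Clow (Cb * CM)) * Mφ :=
        add_le_add le_rfl (mul_le_mul_of_nonneg_right ((le_max_left _ _).trans (le_max_right _ _)) hM)
      set Gs := Real.sqrt (Real.exp (2 * C₀ + (8 * C₀ ^ 2 * T + γ) + (4 * C₀ ^ 2 * T + 1 / (4 * T)) * (Real.sqrt ((pinnedChain ω₂ lam β γ).hamiltonian N x) + Real.sqrt ((pinnedChain ω₂ lam β γ).hamiltonian N y)))) with hGs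
      set G4q := Real.exp (4 * C₀ + (32 * C₀ ^ 2 * T + γ) + (16 * C₀ ^ 2 * T + 1 / (4 * T)) * (Real.sqrt ((pinnedChain ω₂ lam β γ).hamiltonian N x) + Real.sqrt ((pinnedChain ω₂ lam β γ).hamiltonian N y))) ^ (1 / 4 : ℝ) with hG4q
      set Wx := Real.exp (θ₁ * (pinnedChain ω₂ lam β γ).hamiltonian N x) with hWx
      set Wy := Real.exp (θ₁ * (pinnedChain ω₂ lam β γ).hamiltonian N y) with hWy
      set Vx := Real.exp (ϑ * (pinnedChain ω₂ lam β γ).hamiltonian N x) with hVx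
      set Vy := Real.exp (ϑ * (pinnedChain ω₂ lam β γ).hamiltonian N y) with hVy
      set e2 := Real.exp (2 * ϑ * γ * T) with he2
      set e2w := Real.exp (2 * θ₁ * γ * T) with he2w
      set piq := (Real.exp (-(θ₁ * R)) * (Real.exp (θ₁ * γ * (T + T) * ((1 : ℝ≥0) : ℝ)) * Real.exp (θ₁ * (pinnedChain ω₂ lam β γ).hamiltonian N x))) ^ (1 / 4 : ℝ) with hpiq
      set Lr := ((N * (ω₂ / 2 + 3 + lam / ω₂ + N ^ 2 * (3 + β)) + N / 2 + 1) * Real.exp (N * (ω₂ / 2 + 3 + lam / ω₂ + N ^ 2 * (3 + β)) + N / 2 + 1) * (R + 2)) with hLr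
      set eR := Real.exp (ϑ * (R + 1)) with heR
      calc Mφ * eR * CS * ‖x - y‖ + ‖x - y‖ * (Kφ * (G4q * (e2w * (Wx + Wy)) * piq) +
            Mφ * ((Lr + 1) * Gs * (e2 * (Vx + Vy))))
          = Mφ * (eR * CS) * ‖x - y‖ + ‖x - y‖ * (Kφ * (Wx + Wy) * (G4q * (e2w * piq)) +
            Mφ * ((Lr + 1) * (Gs * (e2 * Vx) + Gs * (e2 * Vy)))) := by ring
        _ ≤ Mφ * (eR * CS) * (‖x - y‖ * ((Wx + Wy) / 2)) + ‖x - y‖ * (Kφ * (Wx + Wy) * (1 / 2) +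
            Mφ * ((Lr + 1) * (CM * Wx + CM * Wy))) :=
            add_le_add (mul_le_mul_of_nonneg_left hW2 (by positivity))
              (mul_le_mul_of_nonneg_left (add_le_add (mul_le_mul_of_nonneg_left hsmall (by positivity))
                (mul_le_mul_of_nonneg_left (mul_le_mul_of_nonneg_left (add_le_add t3 t4) hL1) hM)) hxy0)
        _ = (Kφ / 2 + Clow * Mφ) * ‖x - y‖ * (Wx + Wy) := by rw [hClow]; ring
        _ ≤ (Kφ / 2 + max CM (max Clow (Cb * CM)) * Mφ) * ‖x - y‖ * (Wx + Wy) :=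
          mul_le_mul_of_nonneg_right (mul_le_mul_of_nonneg_right hK2 hxy0) (add_nonneg hWx0 hWy0)
  · ------------------------------------------------------------------
    -- (b) the current forecasts
    ------------------------------------------------------------------
    intro t ht x y hxy
    have h := hb t ht x y
    refine h.trans ?_
    have hyx : ‖y - x‖ ≤ 1 := by rwa [norm_sub_rev]
    have hGx : Real.sqrt (Real.exp (2 * C₀ + (8 * C₀ ^ 2 * T + γ) + (4 * C₀ ^ 2 * T + 1 / (4 * T)) * (Real.sqrt ((pinnedChain ω₂ lam β γ).hamiltonian N x) + Real.sqrt ((pinnedChain ω₂ lam β γ).hamiltonian N y)))) ≤ Real.exp ((C₀ + (8 * C₀ ^ 2 * T + γ) / 2 + (2 * C₀ ^ 2 * T + 1 / (8 * T)) * Real.exp ((N * (ω₂ / 2 + 3 + lam / ω₂ + N ^ 2 * (3 + β)) + N / 2 + 1) / 2)) + ((2 * C₀ ^ 2 * T + 1 / (8 * T)) * (1 + Real.exp ((N * (ω₂ / 2 + 3 + lam / ω₂ + N ^ 2 * (3 + β)) + N / 2 + 1) / 2))) * Real.sqrt ((pinnedChain ω₂ lam β γ).hamiltonian N x)) :=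
      sqrt_flowMoment_le hω hl.le hβ.le γ N hT γ x y hxy
    have hGy : Real.sqrt (Real.exp (2 * C₀ + (8 * C₀ ^ 2 * T + γ) + (4 * C₀ ^ 2 * T + 1 / (4 * T)) * (Real.sqrt ((pinnedChain ω₂ lam β γ).hamiltonian N x) + Real.sqrt ((pinnedChain ω₂ lam β γ).hamiltonian N y)))) ≤ Real.exp ((C₀ + (8 * C₀ ^ 2 * T + γ) / 2 + (2 * C₀ ^ 2 * T + 1 / (8 * T)) * Real.exp ((N * (ω₂ / 2 + 3 + lam / ω₂ + N ^ 2 * (3 + β)) + N / 2 + 1) / 2)) + ((2 * C₀ ^ 2 * T + 1 / (8 * T)) * (1 + Real.exp ((N * (ω₂ / 2 + 3 + lam / ω₂ + N ^ 2 * (3 + β)) + N / 2 + 1) / 2))) * Real.sqrt ((pinnedChain ω₂ lam β γ).hamiltonian N y)) := by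
      have h := sqrt_flowMoment_le hω hl.le hβ.le γ N (C₀ := C₀) hT γ y x hyx
      rwa [add_comm (Real.sqrt ((pinnedChain ω₂ lam β γ).hamiltonian N y)) (Real.sqrt ((pinnedChain ω₂ lam β γ).hamiltonian N x))] at h
    have t3 : Real.sqrt (Real.exp (2 * C₀ + (8 * C₀ ^ 2 * T + γ) + (4 * C₀ ^ 2 * T + 1 / (4 * T)) * (Real.sqrt ((pinnedChain ω₂ lam β γ).hamiltonian N x) + Real.sqrt ((pinnedChain ω₂ lam β γ).hamiltonian N y)))) * (Real.exp (2 * ϑ * γ * T) * Real.exp (ϑ * (pinnedChain ω₂ lam β γ).hamiltonian N x)) ≤ CM * Real.exp (θ₁ * (pinnedChain ω₂ lam β γ).hamiltonian N x) :=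
      (mul_le_mul_of_nonneg_right hGx (by positivity)).trans (hCM _ (hH0 x))
    have t4 : Real.sqrt (Real.exp (2 * C₀ + (8 * C₀ ^ 2 * T + γ) + (4 * C₀ ^ 2 * T + 1 / (4 * T)) * (Real.sqrt ((pinnedChain ω₂ lam β γ).hamiltonian N x) + Real.sqrt ((pinnedChain ω₂ lam β γ).hamiltonian N y)))) * (Real.exp (2 * ϑ * γ * T) * Real.exp (ϑ * (pinnedChain ω₂ lam β γ).hamiltonian N y)) ≤ CM * Real.exp (θ₁ * (pinnedChain ω₂ lam β γ).hamiltonian N y) :=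
      (mul_le_mul_of_nonneg_right hGy (by positivity)).trans (hCM _ (hH0 y))
    have hxy0 : 0 ≤ ‖x - y‖ := norm_nonneg _
    have hK3 : Cb * CM ≤ max CM (max Clow (Cb * CM)) := (le_max_right _ _).trans (le_max_right _ _)
    have hWx0 : 0 ≤ Real.exp (θ₁ * (pinnedChain ω₂ lam β γ).hamiltonian N x) := (Real.exp_pos _).le
    have hWy0 : 0 ≤ Real.exp (θ₁ * (pinnedChain ω₂ lam β γ).hamiltonian N y) := (Real.exp_pos _).le
    set Gs := Real.sqrt (Real.exp (2 * C₀ + (8 * C₀ ^ 2 * T + γ) + (4 * C₀ ^ 2 * T + 1 / (4 * T)) * (Real.sqrt ((pinnedChain ω₂ lam β γ).hamiltonian N x) + Real.sqrt ((pinnedChain ω₂ lam β γ).hamiltonian N y)))) with hGs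
    set Wx := Real.exp (θ₁ * (pinnedChain ω₂ lam β γ).hamiltonian N x) with hWx
    set Wy := Real.exp (θ₁ * (pinnedChain ω₂ lam β γ).hamiltonian N y) with hWy
    set Vx := Real.exp (ϑ * (pinnedChain ω₂ lam β γ).hamiltonian N x) with hVx
    set Vy := Real.exp (ϑ * (pinnedChain ω₂ lam β γ).hamiltonian N y) with hVy
    set e2 := Real.exp (2 * ϑ * γ * T) with he2
    calc ‖x - y‖ * (Gs * (Cb * (e2 * (Vx + Vy))))
        = ‖x - y‖ * (Cb * (Gs * (e2 * Vx) + Gs * (e2 * Vy))) := by ring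
      _ ≤ ‖x - y‖ * (Cb * (CM * Wx + CM * Wy)) :=
          mul_le_mul_of_nonneg_left (mul_le_mul_of_nonneg_left (add_le_add t3 t4) hCb0) hxy0
      _ = (Cb * CM) * ‖x - y‖ * (Wx + Wy) := by ring
      _ ≤ max CM (max Clow (Cb * CM)) * ‖x - y‖ * (Wx + Wy) :=
          mul_le_mul_of_nonneg_right (mul_le_mul_of_nonneg_right hK3 hxy0) (add_nonneg hWx0 hWy0)

end Summit.AtomisticToContinuum.FouriersLaw.Cruxes.StaticKubo.Birth.Stubs

end
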